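import Summits.QuantumFields.YangMills.Theorems.ColdStartUniversalityLatticeLangevinWindowIncrements
import Summits.QuantumFields.YangMills.Theorems.ColdStartUniversalityLatticeLangevinBlockScheme
import HarnessLib

/-!
# Route `ColdStartUniversality` (fixed-cut-off SZZ dynamics, sampler package): joint characteristic function of the WINDOW INCREMENTS of
# `s ↦ T^(−1/2)∫₀^(sT) Ĝ(U_r)dr` — the Cramér–Wold step of the finite-dimensional functional CLT

Helper file (seat `ym-line-csu-p1`, g35; `--supports stmt-QuantumFields-24809`).  For a progressively measurable strong solution `U` of the SU(2) SZZ
dynamics from a deterministic start, a continuous `|G| ≤ 1` (`Ĝ = G − μ_(β')G`, `σ² = 2∫₀^∞⟨Ĝ,κ_tĜ⟩_μ dt`), a partition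
`0 = s₀ ≤ s₁ ≤ ⋯ ≤ s_m ≤ 1` and coefficients `a : Fin m → ℝ`,

  `E exp(i Σᵢ aᵢ · T^(−1/2)∫_(sᵢT, sᵢ₊₁T] Ĝ(U_r)dr)  ⟶  exp(−σ² Σᵢ aᵢ²(sᵢ₊₁ − sᵢ)/2)`   as `T → ∞`   (`tendsto_charFun_windowIncrements_of_prog`).

Proof: the block-aligned estimate of file 102b with `J = ⌈T/T^(1/4)⌉` blocks of length `b = T/J` and windows `Kᵢ = ⌈sᵢJ⌉`, weights `cᵢ = aᵢ/Θ`,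
`Θ = Σ|aᵢ| + 1`; the misalignment `|Kᵢb − sᵢT| ≤ b` costs `4Θ b/√T`; `|Kᵢ/J − sᵢ| ≤ 1/J` moves the Gaussian exponent by `≤ σ²Σaᵢ²/J`; all error
terms tend to `0` (the limits of file 94c).  THEOREMS ONLY, no definition, no sorry; [folklore].
HONEST FRAMING: fixed cut-off; `σ²` depends on `L, β'`; `UniformColdStartMixing` (24809) is NOT restated; no crux, rung or summit statement is
proved; the Yang–Mills mass gap is NOT proved.
-/

set_option autoImplicit false

noncomputable section

namespace Summit.QuantumFields.YangMills.Theorems.ColdStartUniversality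

open MeasureTheory ProbabilityTheory Filter Topology Set
open scoped NNReal ENNReal BigOperators
open Literature Literature.Probability.Process Literature.MathematicalPhysics.QuantumFieldTheory
open Literature.MathematicalPhysics.QuantumLattice (fundamentalRep fundamentalLatticeRep continuous_fundamentalRep)

variable {L : ℕ} [NeZero L]

/-- **Cramér–Wold step of the f.d.d. functional CLT.**  For a progressively measurable strong solution `U` from a deterministic start, a
continuous `|G| ≤ 1`, a partition `0 = s₀ ≤ ⋯ ≤ s_m ≤ 1` and coefficients `aᵢ`, the characteristic function at `1` of
`Σᵢ aᵢ T^(−1/2)∫_(sᵢT,sᵢ₊₁T] Ĝ(U_r)dr` tends to `exp(−σ²Σᵢaᵢ²(sᵢ₊₁−sᵢ)/2)` as `T → ∞` (fixed cut-off; `σ² = σ²_(L,β')(G)`). [folklore] -/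
theorem tendsto_charFun_windowIncrements_of_prog (L : ℕ) [NeZero L] (β' : ℝ)
    (κ : ℝ≥0 → Kernel (GaugeConfig 3 L (Matrix.specialUnitaryGroup (Fin 2) ℂ))
      (GaugeConfig 3 L (Matrix.specialUnitaryGroup (Fin 2) ℂ))) [∀ t, IsMarkovKernel (κ t)]
    (hreal : ∀ (t : ℝ≥0) (x : GaugeConfig 3 L (Matrix.specialUnitaryGroup (Fin 2) ℂ))
        (Ω : Type) [MeasurableSpace Ω] (P : Measure Ω) [IsProbabilityMeasure P]
        (W : ℝ≥0 → Ω → (Edge 3 L × NoiseIdx 2 → ℝ)) (hW : IsFlatBrownian W P)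
        (U : ℝ≥0 → Ω → GaugeConfig 3 L (Matrix.specialUnitaryGroup (Fin 2) ℂ)),
        (∀ ω, U 0 ω = x) →
        (latticeLangevinDynamics (fundamentalLatticeRep 2) β').IsSolution (fundamentalRep (Fin 2))
          hW.natFiltration P W U →
        κ t x = P.map (U t))
    (x : GaugeConfig 3 L (Matrix.specialUnitaryGroup (Fin 2) ℂ))
    {Ω : Type} [MeasurableSpace Ω] {P : Measure Ω} [IsProbabilityMeasure P]
    {W : ℝ≥0 → Ω → (Edge 3 L × NoiseIdx 2 → ℝ)} (hW : IsFlatBrownian W P)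
    {U : ℝ≥0 → Ω → GaugeConfig 3 L (Matrix.specialUnitaryGroup (Fin 2) ℂ)} (hU0 : ∀ ω, U 0 ω = x)
    (hU : (latticeLangevinDynamics (fundamentalLatticeRep 2) β').IsSolution (fundamentalRep (Fin 2)) hW.natFiltration P W U)
    (hprog : ∀ i : ℝ≥0, Measurable[@Prod.instMeasurableSpace (Set.Iic i) Ω inferInstance (hW.natFiltration i)]
      (fun q : Set.Iic i × Ω => U q.1 q.2))
    {G : GaugeConfig 3 L (Matrix.specialUnitaryGroup (Fin 2) ℂ) → ℝ} (hGc : Continuous G) (hG1 : ∀ z, |G z| ≤ 1)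
    {σ2 : ℝ} (hσ2 : σ2 = 2 * ∫ t in Ioi (0 : ℝ),
        (∫ y, (G y - ∫ z, G z ∂(wilsonMeasure (d := 3) (L := L) (fundamentalRep (Fin 2)) β')) *
          (∫ z, (G z - ∫ z', G z' ∂(wilsonMeasure (d := 3) (L := L) (fundamentalRep (Fin 2)) β')) ∂(κ t.toNNReal y))
          ∂(wilsonMeasure (d := 3) (L := L) (fundamentalRep (Fin 2)) β')))
    {m : ℕ} (s : ℕ → ℝ) (hs0 : s 0 = 0) (hsmono : Monotone s) (hs1 : s m ≤ 1) (a : Fin m → ℝ) :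
    Tendsto (fun T : ℝ => ∫ ω, Complex.exp (((∑ i : Fin m, a i * ((Real.sqrt T)⁻¹ *
        ∫ r in Ioc (s i * T) (s ((i : ℕ) + 1) * T), (G (U r.toNNReal ω) - ∫ z, G z ∂(wilsonMeasure (d := 3) (L := L) (fundamentalRep (Fin 2)) β'))) : ℝ) : ℂ) *
        Complex.I) ∂P) atTop
      (𝓝 (Complex.exp (-((σ2 * (∑ i : Fin m, a i ^ 2 * (s ((i : ℕ) + 1) - s i)) / 2 : ℝ) : ℂ)))) := by
  classical
  haveI := secondCountableTopology_su2
  haveI := borelSpace_config L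
  set μ : Measure (GaugeConfig 3 L (Matrix.specialUnitaryGroup (Fin 2) ℂ)) :=
    wilsonMeasure (d := 3) (L := L) (fundamentalRep (Fin 2)) β' with hμ
  set mG : ℝ := ∫ z, G z ∂μ with hmG
  set Gh : GaugeConfig 3 L (Matrix.specialUnitaryGroup (Fin 2) ℂ) → ℝ := fun z => G z - mG with hGh
  have hGhm : Measurable Gh := hGc.measurable.sub measurable_const
  have hmG1 : |mG| ≤ 1 := by
    haveI : IsProbabilityMeasure μ :=
      isProbabilityMeasure_wilsonMeasure (d := 3) (L := L) (fundamentalRep (Fin 2)) (continuous_fundamentalRep (Fin 2)) β'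
    have hh := norm_integral_le_of_norm_le_const (μ := μ) (f := G) (C := 1)
      (Eventually.of_forall fun z => by simpa [Real.norm_eq_abs] using hG1 z)
    simpa [Real.norm_eq_abs] using hh
  have hGhb : ∀ z, |Gh z| ≤ 2 := fun z => (abs_sub _ _).trans (by linarith [hG1 z, hmG1])
  have hs_nonneg : ∀ i, 0 ≤ s i := fun i => by rw [← hs0]; exact hsmono (Nat.zero_le i)
  /- ### 1. The finite-time estimate (file 102b), the block scheme, the weights -/
  obtain ⟨βu, K, hβ0, hK, hest⟩ := norm_charFun_windowIncrements_sub_gaussian_le_of_prog L β'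
  have hσ0 : 0 ≤ σ2 := (hest κ hreal x Ω P W hW U hU0 hU hprog G hGc hG1 σ2 hσ2 1 one_pos 1 le_rfl 0 (fun _ => 0) monotone_const rfl
    (Nat.zero_le _) (fun _ => 0) (by simp) 0).1
  set q : ℝ → ℝ := fun T => Real.sqrt (Real.sqrt T) with hq
  set Jf : ℝ → ℕ := fun T => ⌈T / q T⌉₊ with hJf
  set bf : ℝ → ℝ := fun T => T / (Jf T : ℝ) with hbf
  set η : ℝ → ℝ := fun b => K + 2 * βu * ((b * σ2 + K) / Real.sqrt (1 + b) + Real.sqrt (1 + b)) + 4 * βu ^ 2 with hη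
  set Ef : ℝ → ℝ := fun T => η (bf T) / bf T with hEf
  set Bf : ℝ → ℝ := fun T => (2 * βu + 2 * bf T) / Real.sqrt T with hBf
  set Φ : ℝ → ℝ → ℝ := fun θ T => Real.exp (θ ^ 2 * σ2 / 2) * (θ ^ 2 * Ef T + |θ| ^ 3 * Real.exp (|θ| * Bf T) * Bf T * (σ2 + Ef T) +
      θ ^ 4 * σ2 ^ 2 / 4 * (Jf T : ℝ)⁻¹ + (|θ| * Bf T + θ ^ 2 * Bf T ^ 2 / 2) * (θ ^ 2 * σ2 / 2)) +
    |θ| * (2 * βu) * (Real.sqrt T)⁻¹ with hΦ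
  set Kf : ℝ → ℕ → ℕ := fun T i => ⌈s i * (Jf T : ℝ)⌉₊ with hKf
  set Θ : ℝ := ∑ i, |a i| + 1 with hΘ
  have hΘ0 : 0 < Θ := by positivity
  set c : ℕ → ℝ := fun i => if h : i < m then a ⟨i, h⟩ / Θ else 0 with hc
  have hci : ∀ i : Fin m, c i = a i / Θ := fun i => by simp only [hc, dif_pos i.isLt, Fin.eta]
  have hcsum : ∑ i ∈ Finset.range m, |c i| ≤ 1 := by
    have h1 : ∑ i ∈ Finset.range m, |c i| = (∑ i : Fin m, |a i|) / Θ := by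
      rw [Finset.sum_range (fun i => |c i|), Finset.sum_div]
      exact Finset.sum_congr rfl fun i _ => by rw [hci, abs_div, abs_of_pos hΘ0]
    rw [h1, div_le_one hΘ0]; linarith
  set Sa : ℝ := ∑ i : Fin m, a i ^ 2 with hSa
  set Q : ℝ := σ2 * ∑ i : Fin m, a i ^ 2 * (s ((i : ℕ) + 1) - s i) with hQ
  have hQ0 : 0 ≤ Q := mul_nonneg hσ0 (Finset.sum_nonneg fun i _ => mul_nonneg (sq_nonneg _) (sub_nonneg.2 (hsmono (Nat.le_succ _))))
  /- ### 2. Path integrals -/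
  have hpathm : Measurable fun p : Ω × ℝ => U p.2.toNNReal p.1 :=
    measurable_uncurry_of_prog (Z := U) (fun n : ℕ => hW.natFiltration n) (fun n => hW.natFiltration.le n) (fun n => hprog n)
  have hpath : ∀ ω (y : ℝ), IntegrableOn (fun r : ℝ => Gh (U r.toNNReal ω)) (Ioc (0 : ℝ) y) volume := fun ω y =>
    (integrableOn_const (C := (2 : ℝ)) (hs := measure_Ioc_lt_top.ne)).mono'
      ((hGhm.comp (hpathm.comp (measurable_const.prodMk measurable_id))).aestronglyMeasurable)
      (Eventually.of_forall fun r => by rw [Real.norm_eq_abs]; exact hGhb _)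
  have hIm : ∀ lo hi : ℝ, Measurable fun ω => ∫ r in Ioc lo hi, Gh (U r.toNNReal ω) := fun lo hi => by
    have h1 : Measurable (Function.uncurry fun (ω : Ω) (r : ℝ) => Gh (U r.toNNReal ω)) := hGhm.comp hpathm
    exact (h1.stronglyMeasurable.integral_prod_right' (ν := volume.restrict (Ioc lo hi))).measurable
  -- the block scheme: facts at `T ≥ 1` and limits (file `…BlockScheme`)
  have hfacts : ∀ T : ℝ, 1 ≤ T → 1 ≤ (Jf T : ℝ) ∧ (Jf T : ℝ) * bf T = T ∧ q T / 2 ≤ bf T ∧ bf T ≤ q T ∧ q T ≤ (Jf T : ℝ) :=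
    fun T hT => blockScheme_facts hT
  obtain ⟨hb_top, hJ, hB, htb⟩ : Tendsto bf atTop atTop ∧ Tendsto (fun T => (Jf T : ℝ)⁻¹) atTop (𝓝 0) ∧ Tendsto Bf atTop (𝓝 0) ∧
      Tendsto (fun T => bf T * (Real.sqrt T)⁻¹) atTop (𝓝 0) := tendsto_blockScheme βu
  have hE : Tendsto Ef atTop (𝓝 0) := (tendsto_blockDefect_div_atTop K βu σ2).comp hb_top
  have hΦ0 : ∀ θ : ℝ, Tendsto (Φ θ) atTop (𝓝 0) := fun θ => by
    simp only [hΦ]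
    exact tendsto_cltErrorFunctional σ2 βu θ hE hB hJ
  /- ### 3. The exponent: `|Kᵢ/J − sᵢ| ≤ 1/J` -/
  set A : ℝ → ℝ := fun T => Θ ^ 2 * (σ2 * (∑ i ∈ Finset.range m, c i ^ 2 * ((Kf T (i + 1) : ℝ) - Kf T i)) / Jf T) with hA
  have hAQ : ∀ T : ℝ, 1 ≤ T → |A T - Q| ≤ 2 * σ2 * Sa * (Jf T : ℝ)⁻¹ := by
    intro T hT
    obtain ⟨hJ1, -, -, -, -⟩ := hfacts T hT
    have hJ0 : (0 : ℝ) < Jf T := by linarith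
    have hKs : ∀ i, |(Kf T i : ℝ) / Jf T - s i| ≤ (Jf T : ℝ)⁻¹ := fun i => by
      have h1 := Nat.le_ceil (s i * (Jf T : ℝ))
      have h2 := (Nat.ceil_lt_add_one (by have := hs_nonneg i; positivity : 0 ≤ s i * (Jf T : ℝ))).le
      have e : (Kf T i : ℝ) / Jf T - s i = ((Kf T i : ℝ) - s i * Jf T) * (Jf T : ℝ)⁻¹ := by field_simp
      rw [e, abs_mul, abs_of_pos (inv_pos.2 hJ0)]
      calc |(Kf T i : ℝ) - s i * Jf T| * (Jf T : ℝ)⁻¹ ≤ 1 * (Jf T : ℝ)⁻¹ := by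
            refine mul_le_mul_of_nonneg_right ?_ (inv_pos.2 hJ0).le
            simp only [hKf]; rw [abs_le]; constructor <;> linarith
        _ = (Jf T : ℝ)⁻¹ := one_mul _
    have hS : ∑ i ∈ Finset.range m, c i ^ 2 * ((Kf T (i + 1) : ℝ) - Kf T i) = (∑ i : Fin m, a i ^ 2 * ((Kf T ((i : ℕ) + 1) : ℝ) - Kf T i)) / Θ ^ 2 := by
      rw [Finset.sum_range (fun i => c i ^ 2 * ((Kf T (i + 1) : ℝ) - Kf T i)), Finset.sum_div]
      exact Finset.sum_congr rfl fun i _ => by rw [hci, div_pow]; ring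
    have hsd : ∑ i : Fin m, a i ^ 2 * ((Kf T ((i : ℕ) + 1) : ℝ) / Jf T - (Kf T i : ℝ) / Jf T) =
        (∑ i : Fin m, a i ^ 2 * ((Kf T ((i : ℕ) + 1) : ℝ) - Kf T i)) / Jf T := by
      rw [Finset.sum_div]
      exact Finset.sum_congr rfl fun i _ => by rw [← sub_div, mul_div_assoc]
    have hA2 : A T = σ2 * ∑ i : Fin m, a i ^ 2 * ((Kf T ((i : ℕ) + 1) : ℝ) / Jf T - (Kf T i : ℝ) / Jf T) := by
      rw [hsd]; simp only [hA]; rw [hS]; field_simp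
    rw [hA2, hQ, hSa]
    exact abs_mul_sum_sq_mul_sub_sub_le hσ0 a (fun i => (Kf T i : ℝ) / Jf T) s hKs
  /- ### 4. The bound at a fixed `T ≥ 1` -/
  have hboundT : ∀ T : ℝ, 1 ≤ T →
      ‖(∫ ω, Complex.exp (((∑ i : Fin m, a i * ((Real.sqrt T)⁻¹ * ∫ r in Ioc (s i * T) (s ((i : ℕ) + 1) * T), Gh (U r.toNNReal ω)) : ℝ) : ℂ) *
        Complex.I) ∂P) - Complex.exp (-((Q / 2 : ℝ) : ℂ))‖ ≤ 4 * Θ * (bf T * (Real.sqrt T)⁻¹) + Φ Θ T + σ2 * Sa * (Jf T : ℝ)⁻¹ := by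
    intro T hT
    obtain ⟨hJ1, hJb, hbq2, -, -⟩ := hfacts T hT
    have hT0 : 0 < T := by linarith
    have hq0 : 0 < q T := by have := (sqrt_sqrt_facts hT).1; simp only [hq] at *; linarith
    have hb0 : 0 < bf T := lt_of_lt_of_le (by positivity) hbq2
    have ht0 : 0 ≤ (Real.sqrt T)⁻¹ := inv_nonneg.2 (Real.sqrt_nonneg _)
    have hJ1' : 1 ≤ Jf T := by exact_mod_cast hJ1
    have hJ0 : (0 : ℝ) < Jf T := by linarith
    have hKmono : Monotone (Kf T) := fun i j hij => Nat.ceil_mono (mul_le_mul_of_nonneg_right (hsmono hij) hJ0.le)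
    have hK0 : Kf T 0 = 0 := by simp only [hKf, hs0, zero_mul, Nat.ceil_zero]
    have hKm : Kf T m ≤ Jf T := by
      have h1 : ⌈s m * (Jf T : ℝ)⌉₊ ≤ ⌈((Jf T : ℕ) : ℝ)⌉₊ := Nat.ceil_mono (mul_le_of_le_one_left hJ0.le hs1)
      rwa [Nat.ceil_natCast] at h1
    -- window misalignment `|Kᵢ b − sᵢ T| ≤ b`
    have hKb : ∀ i, |(Kf T i : ℝ) * bf T - s i * T| ≤ bf T := fun i => by
      have h1 := Nat.le_ceil (s i * (Jf T : ℝ))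
      have h2 := (Nat.ceil_lt_add_one (by have := hs_nonneg i; positivity : 0 ≤ s i * (Jf T : ℝ))).le
      have e : s i * T = s i * (Jf T : ℝ) * bf T := by rw [mul_assoc, hJb]
      rw [e, ← sub_mul, abs_mul, abs_of_pos hb0]
      calc |(Kf T i : ℝ) - s i * (Jf T : ℝ)| * bf T ≤ 1 * bf T := by
            refine mul_le_mul_of_nonneg_right ?_ hb0.le
            simp only [hKf]; rw [abs_le]; constructor <;> linarith
        _ = bf T := one_mul _
    -- the two statistics
    set statX : Ω → ℝ := fun ω => ∑ i : Fin m, a i * ((Real.sqrt T)⁻¹ * ∫ r in Ioc (s i * T) (s ((i : ℕ) + 1) * T), Gh (U r.toNNReal ω))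
      with hstatX
    set statK : Ω → ℝ := fun ω => Θ * ((Real.sqrt T)⁻¹ * ∑ i ∈ Finset.range m, c i *
      ∫ r in Ioc ((Kf T i : ℝ) * bf T) ((Kf T (i + 1) : ℝ) * bf T), Gh (U r.toNNReal ω)) with hstatK
    have hstatXm : Measurable statX := Finset.measurable_sum _ fun i _ => ((hIm _ _).const_mul _).const_mul _
    have hstatKm : Measurable statK := ((Finset.measurable_sum _ fun i _ => (hIm _ _).const_mul _).const_mul _).const_mul _
    have hdiff : ∀ ω, |statX ω - statK ω| ≤ 4 * Θ * (bf T * (Real.sqrt T)⁻¹) := by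
      intro ω
      have hK' : statK ω = (Real.sqrt T)⁻¹ * ∑ i : Fin m, a i *
          ∫ r in Ioc ((Kf T i : ℝ) * bf T) ((Kf T ((i : ℕ) + 1) : ℝ) * bf T), Gh (U r.toNNReal ω) := by
        simp only [hstatK]
        rw [Finset.sum_range (fun i => c i * ∫ r in Ioc ((Kf T i : ℝ) * bf T) ((Kf T (i + 1) : ℝ) * bf T), Gh (U r.toNNReal ω))]
        simp only [Finset.mul_sum]
        refine Finset.sum_congr rfl fun i _ => ?_
        rw [hci]
        field_simp
      have hX' : statX ω = (Real.sqrt T)⁻¹ * ∑ i : Fin m, a i * ∫ r in Ioc (s i * T) (s ((i : ℕ) + 1) * T), Gh (U r.toNNReal ω) := by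
        simp only [hstatX, Finset.mul_sum]
        exact Finset.sum_congr rfl fun i _ => by ring
      rw [hK', hX', ← mul_sub, ← Finset.sum_sub_distrib, abs_mul, abs_of_nonneg ht0]
      have hterm : ∀ i : Fin m, |a i * (∫ r in Ioc (s i * T) (s ((i : ℕ) + 1) * T), Gh (U r.toNNReal ω)) -
          a i * ∫ r in Ioc ((Kf T i : ℝ) * bf T) ((Kf T ((i : ℕ) + 1) : ℝ) * bf T), Gh (U r.toNNReal ω)| ≤ |a i| * (4 * bf T) := by
        intro i
        rw [← mul_sub, abs_mul]
        refine mul_le_mul_of_nonneg_left ?_ (abs_nonneg _)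
        have hsi : 0 ≤ s i * T := mul_nonneg (hs_nonneg _) hT0.le
        have hsii : s i * T ≤ s ((i : ℕ) + 1) * T := mul_le_mul_of_nonneg_right (hsmono (Nat.le_succ _)) hT0.le
        have hKi : (0 : ℝ) ≤ (Kf T i : ℝ) * bf T := mul_nonneg (Nat.cast_nonneg _) hb0.le
        have hKii : (Kf T i : ℝ) * bf T ≤ (Kf T ((i : ℕ) + 1) : ℝ) * bf T :=
          mul_le_mul_of_nonneg_right (by exact_mod_cast hKmono (Nat.le_succ _)) hb0.le
        have h3 := hKb ((i : ℕ) + 1)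
        have h4 := hKb i
        rw [abs_sub_comm] at h3 h4
        calc |(∫ r in Ioc (s i * T) (s ((i : ℕ) + 1) * T), Gh (U r.toNNReal ω)) -
              ∫ r in Ioc ((Kf T i : ℝ) * bf T) ((Kf T ((i : ℕ) + 1) : ℝ) * bf T), Gh (U r.toNNReal ω)|
            ≤ 2 * (|s ((i : ℕ) + 1) * T - (Kf T ((i : ℕ) + 1) : ℝ) * bf T| + |s i * T - (Kf T i : ℝ) * bf T|) :=
              abs_setIntegral_Ioc_sub_setIntegral_Ioc_le (hpath ω) (fun r => hGhb _) hsi hsii hKi hKii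
          _ ≤ 2 * (bf T + bf T) := mul_le_mul_of_nonneg_left (add_le_add h3 h4) (by norm_num)
          _ = 4 * bf T := by ring
      calc (Real.sqrt T)⁻¹ * |∑ i : Fin m, (a i * (∫ r in Ioc (s i * T) (s ((i : ℕ) + 1) * T), Gh (U r.toNNReal ω)) -
            a i * ∫ r in Ioc ((Kf T i : ℝ) * bf T) ((Kf T ((i : ℕ) + 1) : ℝ) * bf T), Gh (U r.toNNReal ω))|
          ≤ (Real.sqrt T)⁻¹ * ∑ i : Fin m, |a i| * (4 * bf T) :=
            mul_le_mul_of_nonneg_left ((Finset.abs_sum_le_sum_abs _ _).trans (Finset.sum_le_sum fun i _ => hterm i)) ht0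
        _ = (∑ i : Fin m, |a i|) * (4 * bf T) * (Real.sqrt T)⁻¹ := by rw [Finset.sum_mul]; ring
        _ ≤ Θ * (4 * bf T) * (Real.sqrt T)⁻¹ := by gcongr; linarith
        _ = 4 * Θ * (bf T * (Real.sqrt T)⁻¹) := by ring
    have hpert := norm_integral_cexp_sub_integral_cexp_le (P := P) hstatXm hstatKm hdiff 1
    simp only [one_mul, abs_one] at hpert
    -- the Gaussian exponents
    have hexp : ‖Complex.exp (-((A T / 2 : ℝ) : ℂ)) - Complex.exp (-((Q / 2 : ℝ) : ℂ))‖ ≤ σ2 * Sa * (Jf T : ℝ)⁻¹ := by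
      rw [← Complex.ofReal_neg, ← Complex.ofReal_neg, ← Complex.ofReal_exp, ← Complex.ofReal_exp, ← Complex.ofReal_sub, Complex.norm_real,
        Real.norm_eq_abs]
      have hA0 : 0 ≤ A T := by
        simp only [hA]
        refine mul_nonneg (sq_nonneg _) (div_nonneg (mul_nonneg hσ0 (Finset.sum_nonneg fun i _ => mul_nonneg (sq_nonneg _) ?_)) hJ0.le)
        exact sub_nonneg.2 (by exact_mod_cast hKmono (Nat.le_succ i))
      calc |Real.exp (-(A T / 2)) - Real.exp (-(Q / 2))| ≤ |A T - Q| / 2 := abs_exp_neg_half_sub_le hA0 hQ0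
        _ ≤ (2 * σ2 * Sa * (Jf T : ℝ)⁻¹) / 2 := by gcongr; exact hAQ T hT
        _ = σ2 * Sa * (Jf T : ℝ)⁻¹ := by ring
    -- assemble (the estimate of file 102b is invoked last, to keep the context small)
    have hmid : ‖(∫ ω, Complex.exp (((statK ω : ℝ) : ℂ) * Complex.I) ∂P) - Complex.exp (-((A T / 2 : ℝ) : ℂ))‖ ≤ Φ Θ T := by
      have h := (hest κ hreal x Ω P W hW U hU0 hU hprog G hGc hG1 σ2 hσ2 (bf T) hb0 (Jf T) hJ1' m (Kf T) hKmono hK0 hKm c hcsum Θ).2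
      rw [hJb] at h
      simp only [hstatK, hA, hΦ, hEf, hBf, hη]
      exact h
    calc ‖(∫ ω, Complex.exp (((statX ω : ℝ) : ℂ) * Complex.I) ∂P) - Complex.exp (-((Q / 2 : ℝ) : ℂ))‖
        ≤ ‖(∫ ω, Complex.exp (((statX ω : ℝ) : ℂ) * Complex.I) ∂P) - ∫ ω, Complex.exp (((statK ω : ℝ) : ℂ) * Complex.I) ∂P‖ +
          ‖(∫ ω, Complex.exp (((statK ω : ℝ) : ℂ) * Complex.I) ∂P) - Complex.exp (-((Q / 2 : ℝ) : ℂ))‖ := norm_sub_le_norm_sub_add_norm_sub _ _ _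
      _ ≤ 4 * Θ * (bf T * (Real.sqrt T)⁻¹) + (Φ Θ T + σ2 * Sa * (Jf T : ℝ)⁻¹) :=
          add_le_add hpert ((norm_sub_le_norm_sub_add_norm_sub _ _ _).trans (add_le_add hmid hexp))
      _ = 4 * Θ * (bf T * (Real.sqrt T)⁻¹) + Φ Θ T + σ2 * Sa * (Jf T : ℝ)⁻¹ := by ring
  /- ### 5. Conclusion -/
  have hΨ : Tendsto (fun T : ℝ => 4 * Θ * (bf T * (Real.sqrt T)⁻¹) + Φ Θ T + σ2 * Sa * (Jf T : ℝ)⁻¹) atTop (𝓝 0) := by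
    simpa using ((htb.const_mul (4 * Θ)).add (hΦ0 Θ)).add (hJ.const_mul (σ2 * Sa))
  refine tendsto_iff_norm_sub_tendsto_zero.2 (squeeze_zero_norm' ?_ hΨ)
  filter_upwards [eventually_ge_atTop (1 : ℝ)] with T hT
  rw [norm_norm]; exact hboundT T hT

end Summit.QuantumFields.YangMills.Theorems.ColdStartUniversality

end
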